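import Summits.ResolutionOfSingularities.ResolutionOfSingularities.Theorems.FrobeniusLadderFInjectiveMacaulayficationBlowupFiModelOfCoverOverClosed
import Summits.ResolutionOfSingularities.ResolutionOfSingularities.Theorems.FrobeniusLadderFInjectiveMacaulayficationLocallyFixableCore
import Summits.ResolutionOfSingularities.ResolutionOfSingularities.Theorems.FrobeniusLadderFInjectiveMacaulayficationPointFixableOfGoodTower
import Literature.AlgebraicGeometry.Resolution.MonomialOrderReductionUnit
import HarnessLib

/-!
# E7 N4: THE TWO-LEVEL TOWER ASSEMBLY — every stalk of `X″ = Bl_{J₂} X′` over the point `b` downstairs is good, from chart certificates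
# (crux `FInjectiveMacaulayfication` stmt-ResolutionOfSingularities-15315, chain w45a; E7 memo `L/res-L1-w45a-lead-1/E7-SCOPING.md` §2 N4, R12.40)

[OURS · L1 W4.5a · res-L1-w45a-lead-1 gen 4] Support file (`--supports stmt-ResolutionOfSingularities-15315 --as helper`) for the
crux `FrobeniusLadder.FInjectiveMacaulayfication`; NOT a statement of any manuscript; AI-written, weaker than expert review.

The producer of the hypothesis (GOOD) «every stalk of `X″` at a point over `b` is a domain, Cohen–Macaulay, with Frobenius-closed parameter
ideals» of 5h `PointFixableOfGoodTower.pointFixable_of_goodTower` (p512998), for a tower `X″ →(π₂ = Bl_{J₂}) X′ →(π₁) X` with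
`J₂` supported over `b` (E7 memo §0–§1). INPUT (chart form, `e`-free, the currency of `CertifiedChartCentre`/`LocallyFixable`): a finite
family of affine opens `U σ` of `X′` covering `π₁⁻¹(b)`; for each σ the FIBRE IDEAL `𝔟 σ ⊆ Γ(X′, U σ)` («a point of the chart lies over
`b` ⇒ its prime contains `𝔟 σ`»), a cover family `v σ ⊆ I σ := J₂.ideal (U σ)` of the Rees algebra (`irrelevant ≤ √(vⱼt)`), and the two
certificate blocks of N2 `BlowupFiModelOfCoverOverClosed.blowupClause_over_closed` (p522238): the clause of `Γ(U σ)` at its MAXIMAL ideals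
over `b` off `V(I σ)` (level-1 certificates) and the clause of the affine blow-up algebras `Γ(U σ)[I σ/vⱼ]` at the exceptional maximal
ideals over `b` (level-2 certificates). OUTPUT (`twoLevelTower_good`): for EVERY blow-up `π₂ : X″ ⟶ X′` along `J₂`, (GOOD). Proof: a point
`x″` over `b` maps to some `U σ`; its stalk is a stalk of `affineBlowup (J₂.ideal (U σ))` at a point over the fibre
(`LocallyFixableCore.exists_stalk_ringEquiv_over`, p509687 — M1 `IsBlowup.exists_chartImmersion`), which N2 certifies; transport along the
ring isomorphism. Charts off the level-2 centre are the case `I σ = ⊤` (cover family `v = (1)`, no exceptional maximal ideals). COROLLARY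
(`pointFixable_of_twoLevelTower`): with level-1 data `J₁` point-supported at `b`, `π₁ = Bl_{J₁}`, `J₂ ≠ ⊥` f.g. supported over `b`, 5h gives
PFix(𝒪_{X,b}) — the 5e instance at `b`. No definitions, no named facts. [folklore]
-/

-- single-problem summit: the doubled namespace component is forced
set_option linter.dupNamespace false

noncomputable section

namespace Summit.ResolutionOfSingularities.ResolutionOfSingularities.Theorems.FInjectiveMacaulayfication.TwoLevelTower

open AlgebraicGeometry CategoryTheory Literature.AlgebraicGeometry.Resolution TopologicalSpace
open Summit.ResolutionOfSingularities.ResolutionOfSingularities.Theorems.FInjectiveMacaulayfication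

/-- **E7 N4 — (GOOD) for a two-level tower from chart certificates.** See the module docstring. [folklore] -/
theorem twoLevelTower_good (p : ℕ) [Fact p.Prime] (X X' : Scheme.{0}) (π₁ : X' ⟶ X) (b : X) (J₂ : X'.IdealSheafData)
    (N : ℕ) (U : Fin N → X'.affineOpens) (hcover : ∀ x' : X', π₁.base x' = b → ∃ σ : Fin N, x' ∈ (U σ : X'.Opens))
    (hdom : ∀ σ : Fin N, IsDomain Γ(X', U σ)) (hnoeth : ∀ σ : Fin N, IsNoetherianRing Γ(X', U σ))
    (hjac : ∀ σ : Fin N, IsJacobsonRing Γ(X', U σ)) (hchar : ∀ σ : Fin N, CharP Γ(X', U σ) p)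
    (𝔟 : ∀ σ : Fin N, Ideal Γ(X', U σ))
    (h𝔟 : ∀ (σ : Fin N) (z : ↥(Spec Γ(X', U σ))), π₁.base ((U σ).2.fromSpec.base z) = b → 𝔟 σ ≤ z.asIdeal)
    (t : Fin N → ℕ) (v : ∀ σ : Fin N, Fin (t σ) → Γ(X', U σ)) (hv : ∀ σ j, v σ j ∈ J₂.ideal (U σ))
    (hv0 : ∀ σ j, v σ j ≠ 0)
    (hcov : ∀ σ : Fin N, (HomogeneousIdeal.irrelevant (reesGrading (J₂.ideal (U σ)))).toIdeal ≤
      (Ideal.span (Set.range fun j : Fin (t σ) => reesT (I := J₂.ideal (U σ)) (v σ j) (hv σ j))).radical)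
    (hoff : ∀ (σ : Fin N) (Q : Ideal Γ(X', U σ)) [Q.IsMaximal], ¬ J₂.ideal (U σ) ≤ Q → 𝔟 σ ≤ Q →
      ∀ d : ℕ, ringKrullDim (Localization.AtPrime Q) = d → ∀ s : Fin d → Localization.AtPrime Q,
        (Ideal.span (Set.range s)).radical.IsMaximal →
          RingTheory.Sequence.IsWeaklyRegular (Localization.AtPrime Q) (List.ofFn s) ∧
          ∀ y : Localization.AtPrime Q, (∃ e : ℕ, y ^ p ^ e ∈ Ideal.span
            ((fun z : Localization.AtPrime Q => z ^ p ^ e) ''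
              (Ideal.span (Set.range s) : Set (Localization.AtPrime Q)))) → y ∈ Ideal.span (Set.range s))
    (hon : ∀ (σ : Fin N) (j : Fin (t σ)) (Q : Ideal (Literature.AlgebraicGeometry.Resolution.blowupAlgebra (J₂.ideal (U σ)) (v σ j))) [Q.IsMaximal],
      algebraMap Γ(X', U σ) (Literature.AlgebraicGeometry.Resolution.blowupAlgebra (J₂.ideal (U σ)) (v σ j)) (v σ j) ∈ Q →
      (𝔟 σ).map (algebraMap Γ(X', U σ) (Literature.AlgebraicGeometry.Resolution.blowupAlgebra (J₂.ideal (U σ)) (v σ j))) ≤ Q →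
      ∀ d : ℕ, ringKrullDim (Localization.AtPrime Q) = d → ∀ s : Fin d → Localization.AtPrime Q,
        (Ideal.span (Set.range s)).radical.IsMaximal →
          RingTheory.Sequence.IsWeaklyRegular (Localization.AtPrime Q) (List.ofFn s) ∧
          ∀ y : Localization.AtPrime Q, (∃ e : ℕ, y ^ p ^ e ∈ Ideal.span
            ((fun z : Localization.AtPrime Q => z ^ p ^ e) ''
              (Ideal.span (Set.range s) : Set (Localization.AtPrime Q)))) → y ∈ Ideal.span (Set.range s)) :
    ∀ (X'' : Scheme.{0}) (π₂ : X'' ⟶ X'), IsBlowup π₂ J₂ →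
      ∀ x'' : X'', π₁.base (π₂.base x'') = b → IsDomain (X''.presheaf.stalk x'') ∧ ∀ d : ℕ, ringKrullDim (X''.presheaf.stalk x'') = d → ∀ s : Fin d → X''.presheaf.stalk x'', (Ideal.span (Set.range s)).radical.IsMaximal → RingTheory.Sequence.IsWeaklyRegular (X''.presheaf.stalk x'') (List.ofFn s) ∧ ∀ y : X''.presheaf.stalk x'', (∃ e : ℕ, y ^ p ^ e ∈ Ideal.span ((fun z : X''.presheaf.stalk x'' => z ^ p ^ e) '' (Ideal.span (Set.range s) : Set (X''.presheaf.stalk x'')))) → y ∈ Ideal.span (Set.range s) := by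
  intro X'' π₂ hπ₂ x'' hx''
  obtain ⟨σ, hσ⟩ := hcover (π₂.base x'') hx''
  haveI := hdom σ
  haveI := hnoeth σ
  haveI := hjac σ
  haveI := hchar σ
  -- the stalk of `X″` at `x″` is a stalk of the affine blow-up of the chart
  obtain ⟨y, hy, ⟨e⟩⟩ := LocallyFixable.exists_stalk_ringEquiv_over X' X'' J₂ π₂ hπ₂ (U σ) x'' hσ
  -- `y` lies over the fibre `V(𝔟 σ)`
  have hby : 𝔟 σ ≤ ((affineBlowup.π (J₂.ideal (U σ))).base y).asIdeal := by
    refine h𝔟 σ _ ?_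
    have h1 : ((U σ).2.fromSpec).base ((affineBlowup.π (J₂.ideal (U σ))).base y) = π₂.base x'' := hy
    rw [h1]
    exact hx''
  obtain ⟨hdomy, hcly⟩ := BlowupFiModelOfCoverOverClosed.blowupClause_over_closed p Γ(X', U σ) (J₂.ideal (U σ)) (t σ) (v σ)
    (hv σ) (hv0 σ) (hcov σ) (𝔟 σ) (fun Q _ hQI hQb => hoff σ Q hQI hQb) (fun j Q _ hQv hQb => hon σ j Q hQv hQb) y hby
  haveI := hdomy
  exact ⟨MulEquiv.isDomain _ e.toMulEquiv,
    DegreeZeroDescent.inlineClause_of_ringEquiv p e.symm hcly⟩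

/-- **PFix at `b` from a certified two-level tower** (E7 memo §2 N4, corollary): the data of `twoLevelTower_good` together with the
tower bookkeeping of 5h `PointFixableOfGoodTower.pointFixable_of_goodTower` (p512998: `J₁` point-supported at the closed point `b`,
`π₁ = Bl_{J₁}`, `J₂ ≠ ⊥` finitely generated and supported over `b`, `π₂ = Bl_{J₂}`) give point-fixability of `𝒪_{X,b}` — the 5e
instance at `b`. [folklore] -/
theorem pointFixable_of_twoLevelTower (p : ℕ) [Fact p.Prime] (X : Scheme.{0}) [CompactSpace X] [QuasiSeparatedSpace X]
    [IsIntegral X] [IsLocallyNoetherian X] (b : X) (hb : IsClosed ({b} : Set X))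
    (J₁ : X.IdealSheafData) (hJ₁fg : ∀ W : X.affineOpens, (J₁.ideal W).FG) (hJ₁ : J₁ ≠ ⊥) (hsupp₁ : (J₁.support : Set X) = {b})
    (X' : Scheme.{0}) (π₁ : X' ⟶ X) (hπ₁ : IsBlowup π₁ J₁)
    (J₂ : X'.IdealSheafData) (hJ₂fg : ∀ W : X'.affineOpens, (J₂.ideal W).FG) (hJ₂ : J₂ ≠ ⊥)
    (hsupp₂ : (J₂.support : Set X') ⊆ π₁.base ⁻¹' {b})
    (X'' : Scheme.{0}) (π₂ : X'' ⟶ X') (hπ₂ : IsBlowup π₂ J₂)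
    (N : ℕ) (U : Fin N → X'.affineOpens) (hcover : ∀ x' : X', π₁.base x' = b → ∃ σ : Fin N, x' ∈ (U σ : X'.Opens))
    (hdom : ∀ σ : Fin N, IsDomain Γ(X', U σ)) (hnoeth : ∀ σ : Fin N, IsNoetherianRing Γ(X', U σ))
    (hjac : ∀ σ : Fin N, IsJacobsonRing Γ(X', U σ)) (hchar : ∀ σ : Fin N, CharP Γ(X', U σ) p)
    (𝔟 : ∀ σ : Fin N, Ideal Γ(X', U σ))
    (h𝔟 : ∀ (σ : Fin N) (z : ↥(Spec Γ(X', U σ))), π₁.base ((U σ).2.fromSpec.base z) = b → 𝔟 σ ≤ z.asIdeal)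
    (t : Fin N → ℕ) (v : ∀ σ : Fin N, Fin (t σ) → Γ(X', U σ)) (hv : ∀ σ j, v σ j ∈ J₂.ideal (U σ))
    (hv0 : ∀ σ j, v σ j ≠ 0)
    (hcov : ∀ σ : Fin N, (HomogeneousIdeal.irrelevant (reesGrading (J₂.ideal (U σ)))).toIdeal ≤
      (Ideal.span (Set.range fun j : Fin (t σ) => reesT (I := J₂.ideal (U σ)) (v σ j) (hv σ j))).radical)
    (hoff : ∀ (σ : Fin N) (Q : Ideal Γ(X', U σ)) [Q.IsMaximal], ¬ J₂.ideal (U σ) ≤ Q → 𝔟 σ ≤ Q →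
      ∀ d : ℕ, ringKrullDim (Localization.AtPrime Q) = d → ∀ s : Fin d → Localization.AtPrime Q,
        (Ideal.span (Set.range s)).radical.IsMaximal →
          RingTheory.Sequence.IsWeaklyRegular (Localization.AtPrime Q) (List.ofFn s) ∧
          ∀ y : Localization.AtPrime Q, (∃ e : ℕ, y ^ p ^ e ∈ Ideal.span
            ((fun z : Localization.AtPrime Q => z ^ p ^ e) ''
              (Ideal.span (Set.range s) : Set (Localization.AtPrime Q)))) → y ∈ Ideal.span (Set.range s))
    (hon : ∀ (σ : Fin N) (j : Fin (t σ)) (Q : Ideal (Literature.AlgebraicGeometry.Resolution.blowupAlgebra (J₂.ideal (U σ)) (v σ j))) [Q.IsMaximal],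
      algebraMap Γ(X', U σ) (Literature.AlgebraicGeometry.Resolution.blowupAlgebra (J₂.ideal (U σ)) (v σ j)) (v σ j) ∈ Q →
      (𝔟 σ).map (algebraMap Γ(X', U σ) (Literature.AlgebraicGeometry.Resolution.blowupAlgebra (J₂.ideal (U σ)) (v σ j))) ≤ Q →
      ∀ d : ℕ, ringKrullDim (Localization.AtPrime Q) = d → ∀ s : Fin d → Localization.AtPrime Q,
        (Ideal.span (Set.range s)).radical.IsMaximal →
          RingTheory.Sequence.IsWeaklyRegular (Localization.AtPrime Q) (List.ofFn s) ∧
          ∀ y : Localization.AtPrime Q, (∃ e : ℕ, y ^ p ^ e ∈ Ideal.span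
            ((fun z : Localization.AtPrime Q => z ^ p ^ e) ''
              (Ideal.span (Set.range s) : Set (Localization.AtPrime Q)))) → y ∈ Ideal.span (Set.range s)) :
    (∃ (n : ℕ) (c : Fin n → X.presheaf.stalk b), Ideal.span (Set.range c) ≠ ⊥ ∧ (Ideal.span (Set.range c)).radical = IsLocalRing.maximalIdeal (X.presheaf.stalk b) ∧
        ∀ (j : Fin n) (𝔔 : PrimeSpectrum (Literature.AlgebraicGeometry.Resolution.blowupAlgebra (Ideal.span (Set.range c)) (c j))),
          𝔔.asIdeal.comap (algebraMap (X.presheaf.stalk b) (Literature.AlgebraicGeometry.Resolution.blowupAlgebra (Ideal.span (Set.range c)) (c j))) = IsLocalRing.maximalIdeal (X.presheaf.stalk b) →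
          IsDomain (Localization.AtPrime 𝔔.asIdeal) ∧ ∀ d : ℕ, ringKrullDim (Localization.AtPrime 𝔔.asIdeal) = d → ∀ s : Fin d → Localization.AtPrime 𝔔.asIdeal, (Ideal.span (Set.range s)).radical.IsMaximal → RingTheory.Sequence.IsWeaklyRegular (Localization.AtPrime 𝔔.asIdeal) (List.ofFn s) ∧ ∀ y : Localization.AtPrime 𝔔.asIdeal, (∃ e : ℕ, y ^ p ^ e ∈ Ideal.span ((fun z : Localization.AtPrime 𝔔.asIdeal => z ^ p ^ e) '' (Ideal.span (Set.range s) : Set (Localization.AtPrime 𝔔.asIdeal)))) → y ∈ Ideal.span (Set.range s)) :=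
  PointFixableOfGoodTower.pointFixable_of_goodTower p X b hb J₁ hJ₁fg hJ₁ hsupp₁ X' π₁ hπ₁ J₂ hJ₂fg hJ₂ hsupp₂ X'' π₂ hπ₂
    (twoLevelTower_good p X X' π₁ b J₂ N U hcover hdom hnoeth hjac hchar 𝔟 h𝔟 t v hv hv0 hcov hoff hon X'' π₂ hπ₂)

/-! ## N4′ — the same with charts only around the support of `J₂` (appended by res-L1-w45a-lead-1 gen 4, E7 instance layer)

For the T₁₁/3-type instances the second centre `C̄ = supp J₂` is covered by FEW charts carrying level-2 certificates (two toric
charts for T₁₁/3, strat-1 `T11-P3-TOWER` §1), while level 1 is certified everywhere over `b` off `C̄` in STALK currency. So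
`twoLevelTower_good_of_suppCover` asks for the chart data (`hdom … hon`) only on a family `U : ι → X′.affineOpens` covering
`supp J₂` over `b`, and for the FULL clause at the stalks of `X′` over `b` OFF `supp J₂` (`hoffStalk`); off the support `π₂`
is a local isomorphism (`IsBlowup.isIso_stalkMap_of_not_mem_support`, Stacks 02OS) and the clause moves along the stalk
isomorphism (`fiClause_of_ringEquiv`); on the support the proof is N4's verbatim. Index type `ι` arbitrary. -/

/-- **E7 N4′ — (GOOD) for a two-level tower, charts only around `supp J₂`.** Level 1 good over `b` off `supp J₂` in stalk
currency (`hoffStalk`) + N4's chart certificates on a family covering `supp J₂` over `b` ⊢ every blowing up of `X′` along `J₂`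
satisfies the FULL clause at every point over `b`. [folklore] -/
theorem twoLevelTower_good_of_suppCover (p : ℕ) [Fact p.Prime] (X X' : Scheme.{0}) (π₁ : X' ⟶ X) (b : X) (J₂ : X'.IdealSheafData)
    -- off the support of `J₂` over `b`, level 1 is already good (stalk currency)
    (hoffStalk : ∀ x' : X', π₁.base x' = b → x' ∉ J₂.support →
      (IsDomain (X'.presheaf.stalk x') ∧ ∀ d : ℕ, ringKrullDim (X'.presheaf.stalk x') = d → ∀ s : Fin d → X'.presheaf.stalk x',
        (Ideal.span (Set.range s)).radical.IsMaximal → RingTheory.Sequence.IsWeaklyRegular (X'.presheaf.stalk x') (List.ofFn s) ∧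
        ∀ y : X'.presheaf.stalk x', (∃ e : ℕ, y ^ p ^ e ∈ Ideal.span ((fun z : X'.presheaf.stalk x' => z ^ p ^ e) ''
          (Ideal.span (Set.range s) : Set (X'.presheaf.stalk x')))) → y ∈ Ideal.span (Set.range s)))
    -- charts are only needed around the support of `J₂` over `b`
    {ι : Type} (U : ι → X'.affineOpens) (hcover : ∀ x' : X', π₁.base x' = b → x' ∈ J₂.support → ∃ σ : ι, x' ∈ (U σ : X'.Opens))
    (hdom : ∀ σ : ι, IsDomain Γ(X', U σ)) (hnoeth : ∀ σ : ι, IsNoetherianRing Γ(X', U σ))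
    (hjac : ∀ σ : ι, IsJacobsonRing Γ(X', U σ)) (hchar : ∀ σ : ι, CharP Γ(X', U σ) p)
    (𝔟 : ∀ σ : ι, Ideal Γ(X', U σ))
    (h𝔟 : ∀ (σ : ι) (z : ↥(Spec Γ(X', U σ))), π₁.base ((U σ).2.fromSpec.base z) = b → 𝔟 σ ≤ z.asIdeal)
    (t : ι → ℕ) (v : ∀ σ : ι, Fin (t σ) → Γ(X', U σ)) (hv : ∀ σ j, v σ j ∈ J₂.ideal (U σ))
    (hv0 : ∀ σ j, v σ j ≠ 0)
    (hcov : ∀ σ : ι, (HomogeneousIdeal.irrelevant (reesGrading (J₂.ideal (U σ)))).toIdeal ≤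
      (Ideal.span (Set.range fun j : Fin (t σ) => reesT (I := J₂.ideal (U σ)) (v σ j) (hv σ j))).radical)
    (hoff : ∀ (σ : ι) (Q : Ideal Γ(X', U σ)) [Q.IsMaximal], ¬ J₂.ideal (U σ) ≤ Q → 𝔟 σ ≤ Q →
      ∀ d : ℕ, ringKrullDim (Localization.AtPrime Q) = d → ∀ s : Fin d → Localization.AtPrime Q,
        (Ideal.span (Set.range s)).radical.IsMaximal →
          RingTheory.Sequence.IsWeaklyRegular (Localization.AtPrime Q) (List.ofFn s) ∧
          ∀ y : Localization.AtPrime Q, (∃ e : ℕ, y ^ p ^ e ∈ Ideal.span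
            ((fun z : Localization.AtPrime Q => z ^ p ^ e) ''
              (Ideal.span (Set.range s) : Set (Localization.AtPrime Q)))) → y ∈ Ideal.span (Set.range s))
    (hon : ∀ (σ : ι) (j : Fin (t σ)) (Q : Ideal (Literature.AlgebraicGeometry.Resolution.blowupAlgebra (J₂.ideal (U σ)) (v σ j))) [Q.IsMaximal],
      algebraMap Γ(X', U σ) (Literature.AlgebraicGeometry.Resolution.blowupAlgebra (J₂.ideal (U σ)) (v σ j)) (v σ j) ∈ Q →
      (𝔟 σ).map (algebraMap Γ(X', U σ) (Literature.AlgebraicGeometry.Resolution.blowupAlgebra (J₂.ideal (U σ)) (v σ j))) ≤ Q →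
      ∀ d : ℕ, ringKrullDim (Localization.AtPrime Q) = d → ∀ s : Fin d → Localization.AtPrime Q,
        (Ideal.span (Set.range s)).radical.IsMaximal →
          RingTheory.Sequence.IsWeaklyRegular (Localization.AtPrime Q) (List.ofFn s) ∧
          ∀ y : Localization.AtPrime Q, (∃ e : ℕ, y ^ p ^ e ∈ Ideal.span
            ((fun z : Localization.AtPrime Q => z ^ p ^ e) ''
              (Ideal.span (Set.range s) : Set (Localization.AtPrime Q)))) → y ∈ Ideal.span (Set.range s)) :
    ∀ (X'' : Scheme.{0}) (π₂ : X'' ⟶ X'), IsBlowup π₂ J₂ →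
      ∀ x'' : X'', π₁.base (π₂.base x'') = b → IsDomain (X''.presheaf.stalk x'') ∧ ∀ d : ℕ, ringKrullDim (X''.presheaf.stalk x'') = d → ∀ s : Fin d → X''.presheaf.stalk x'', (Ideal.span (Set.range s)).radical.IsMaximal → RingTheory.Sequence.IsWeaklyRegular (X''.presheaf.stalk x'') (List.ofFn s) ∧ ∀ y : X''.presheaf.stalk x'', (∃ e : ℕ, y ^ p ^ e ∈ Ideal.span ((fun z : X''.presheaf.stalk x'' => z ^ p ^ e) '' (Ideal.span (Set.range s) : Set (X''.presheaf.stalk x'')))) → y ∈ Ideal.span (Set.range s) := by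
  intro X'' π₂ hπ₂ x'' hx''
  by_cases hxsupp : π₂.base x'' ∈ J₂.support
  · obtain ⟨σ, hσ⟩ := hcover (π₂.base x'') hx'' hxsupp
    haveI := hdom σ
    haveI := hnoeth σ
    haveI := hjac σ
    haveI := hchar σ
    -- the stalk of `X″` at `x″` is a stalk of the affine blow-up of the chart
    obtain ⟨y, hy, ⟨e⟩⟩ := LocallyFixable.exists_stalk_ringEquiv_over X' X'' J₂ π₂ hπ₂ (U σ) x'' hσ
    -- `y` lies over the fibre `V(𝔟 σ)`
    have hby : 𝔟 σ ≤ ((affineBlowup.π (J₂.ideal (U σ))).base y).asIdeal := by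
      refine h𝔟 σ _ ?_
      have h1 : ((U σ).2.fromSpec).base ((affineBlowup.π (J₂.ideal (U σ))).base y) = π₂.base x'' := hy
      rw [h1]
      exact hx''
    obtain ⟨hdomy, hcly⟩ := BlowupFiModelOfCoverOverClosed.blowupClause_over_closed p Γ(X', U σ) (J₂.ideal (U σ)) (t σ) (v σ)
      (hv σ) (hv0 σ) (hcov σ) (𝔟 σ) (fun Q _ hQI hQb => hoff σ Q hQI hQb) (fun j Q _ hQv hQb => hon σ j Q hQv hQb) y hby
    haveI := hdomy
    exact ⟨MulEquiv.isDomain _ e.toMulEquiv,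
      DegreeZeroDescent.inlineClause_of_ringEquiv p e.symm hcly⟩
  · -- off the support `π₂` is a local isomorphism (`IsBlowup.isIso_stalkMap_of_not_mem_support`, Stacks 02OS): transport level 1
    have hgood := hoffStalk (π₂.base x'') hx'' hxsupp
    haveI : IsIso (π₂.stalkMap x'') := hπ₂.isIso_stalkMap_of_not_mem_support hxsupp
    exact fiClause_of_ringEquiv p (asIso (π₂.stalkMap x'')).commRingCatIsoToRingEquiv hgood

/-- **PFix at `b` from a certified two-level tower, charts only around `supp J₂`** (= `pointFixable_of_twoLevelTower` with N4′
in place of N4; 5h `PointFixableOfGoodTower.pointFixable_of_goodTower` does the tower bookkeeping). [folklore] -/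
theorem pointFixable_of_twoLevelTower_suppCover (p : ℕ) [Fact p.Prime] (X : Scheme.{0}) [CompactSpace X] [QuasiSeparatedSpace X]
    [IsIntegral X] [IsLocallyNoetherian X] (b : X) (hb : IsClosed ({b} : Set X))
    (J₁ : X.IdealSheafData) (hJ₁fg : ∀ W : X.affineOpens, (J₁.ideal W).FG) (hJ₁ : J₁ ≠ ⊥) (hsupp₁ : (J₁.support : Set X) = {b})
    (X' : Scheme.{0}) (π₁ : X' ⟶ X) (hπ₁ : IsBlowup π₁ J₁)
    (J₂ : X'.IdealSheafData) (hJ₂fg : ∀ W : X'.affineOpens, (J₂.ideal W).FG) (hJ₂ : J₂ ≠ ⊥)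
    (hsupp₂ : (J₂.support : Set X') ⊆ π₁.base ⁻¹' {b})
    (X'' : Scheme.{0}) (π₂ : X'' ⟶ X') (hπ₂ : IsBlowup π₂ J₂)
    -- off the support of `J₂` over `b`, level 1 is already good (stalk currency)
    (hoffStalk : ∀ x' : X', π₁.base x' = b → x' ∉ J₂.support →
      (IsDomain (X'.presheaf.stalk x') ∧ ∀ d : ℕ, ringKrullDim (X'.presheaf.stalk x') = d → ∀ s : Fin d → X'.presheaf.stalk x',
        (Ideal.span (Set.range s)).radical.IsMaximal → RingTheory.Sequence.IsWeaklyRegular (X'.presheaf.stalk x') (List.ofFn s) ∧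
        ∀ y : X'.presheaf.stalk x', (∃ e : ℕ, y ^ p ^ e ∈ Ideal.span ((fun z : X'.presheaf.stalk x' => z ^ p ^ e) ''
          (Ideal.span (Set.range s) : Set (X'.presheaf.stalk x')))) → y ∈ Ideal.span (Set.range s)))
    -- charts are only needed around the support of `J₂` over `b`
    {ι : Type} (U : ι → X'.affineOpens) (hcover : ∀ x' : X', π₁.base x' = b → x' ∈ J₂.support → ∃ σ : ι, x' ∈ (U σ : X'.Opens))
    (hdom : ∀ σ : ι, IsDomain Γ(X', U σ)) (hnoeth : ∀ σ : ι, IsNoetherianRing Γ(X', U σ))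
    (hjac : ∀ σ : ι, IsJacobsonRing Γ(X', U σ)) (hchar : ∀ σ : ι, CharP Γ(X', U σ) p)
    (𝔟 : ∀ σ : ι, Ideal Γ(X', U σ))
    (h𝔟 : ∀ (σ : ι) (z : ↥(Spec Γ(X', U σ))), π₁.base ((U σ).2.fromSpec.base z) = b → 𝔟 σ ≤ z.asIdeal)
    (t : ι → ℕ) (v : ∀ σ : ι, Fin (t σ) → Γ(X', U σ)) (hv : ∀ σ j, v σ j ∈ J₂.ideal (U σ))
    (hv0 : ∀ σ j, v σ j ≠ 0)
    (hcov : ∀ σ : ι, (HomogeneousIdeal.irrelevant (reesGrading (J₂.ideal (U σ)))).toIdeal ≤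
      (Ideal.span (Set.range fun j : Fin (t σ) => reesT (I := J₂.ideal (U σ)) (v σ j) (hv σ j))).radical)
    (hoff : ∀ (σ : ι) (Q : Ideal Γ(X', U σ)) [Q.IsMaximal], ¬ J₂.ideal (U σ) ≤ Q → 𝔟 σ ≤ Q →
      ∀ d : ℕ, ringKrullDim (Localization.AtPrime Q) = d → ∀ s : Fin d → Localization.AtPrime Q,
        (Ideal.span (Set.range s)).radical.IsMaximal →
          RingTheory.Sequence.IsWeaklyRegular (Localization.AtPrime Q) (List.ofFn s) ∧
          ∀ y : Localization.AtPrime Q, (∃ e : ℕ, y ^ p ^ e ∈ Ideal.span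
            ((fun z : Localization.AtPrime Q => z ^ p ^ e) ''
              (Ideal.span (Set.range s) : Set (Localization.AtPrime Q)))) → y ∈ Ideal.span (Set.range s))
    (hon : ∀ (σ : ι) (j : Fin (t σ)) (Q : Ideal (Literature.AlgebraicGeometry.Resolution.blowupAlgebra (J₂.ideal (U σ)) (v σ j))) [Q.IsMaximal],
      algebraMap Γ(X', U σ) (Literature.AlgebraicGeometry.Resolution.blowupAlgebra (J₂.ideal (U σ)) (v σ j)) (v σ j) ∈ Q →
      (𝔟 σ).map (algebraMap Γ(X', U σ) (Literature.AlgebraicGeometry.Resolution.blowupAlgebra (J₂.ideal (U σ)) (v σ j))) ≤ Q →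
      ∀ d : ℕ, ringKrullDim (Localization.AtPrime Q) = d → ∀ s : Fin d → Localization.AtPrime Q,
        (Ideal.span (Set.range s)).radical.IsMaximal →
          RingTheory.Sequence.IsWeaklyRegular (Localization.AtPrime Q) (List.ofFn s) ∧
          ∀ y : Localization.AtPrime Q, (∃ e : ℕ, y ^ p ^ e ∈ Ideal.span
            ((fun z : Localization.AtPrime Q => z ^ p ^ e) ''
              (Ideal.span (Set.range s) : Set (Localization.AtPrime Q)))) → y ∈ Ideal.span (Set.range s)) :
    (∃ (n : ℕ) (c : Fin n → X.presheaf.stalk b), Ideal.span (Set.range c) ≠ ⊥ ∧ (Ideal.span (Set.range c)).radical = IsLocalRing.maximalIdeal (X.presheaf.stalk b) ∧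
        ∀ (j : Fin n) (𝔔 : PrimeSpectrum (Literature.AlgebraicGeometry.Resolution.blowupAlgebra (Ideal.span (Set.range c)) (c j))),
          𝔔.asIdeal.comap (algebraMap (X.presheaf.stalk b) (Literature.AlgebraicGeometry.Resolution.blowupAlgebra (Ideal.span (Set.range c)) (c j))) = IsLocalRing.maximalIdeal (X.presheaf.stalk b) →
          IsDomain (Localization.AtPrime 𝔔.asIdeal) ∧ ∀ d : ℕ, ringKrullDim (Localization.AtPrime 𝔔.asIdeal) = d → ∀ s : Fin d → Localization.AtPrime 𝔔.asIdeal, (Ideal.span (Set.range s)).radical.IsMaximal → RingTheory.Sequence.IsWeaklyRegular (Localization.AtPrime 𝔔.asIdeal) (List.ofFn s) ∧ ∀ y : Localization.AtPrime 𝔔.asIdeal, (∃ e : ℕ, y ^ p ^ e ∈ Ideal.span ((fun z : Localization.AtPrime 𝔔.asIdeal => z ^ p ^ e) '' (Ideal.span (Set.range s) : Set (Localization.AtPrime 𝔔.asIdeal)))) → y ∈ Ideal.span (Set.range s)) :=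
  PointFixableOfGoodTower.pointFixable_of_goodTower p X b hb J₁ hJ₁fg hJ₁ hsupp₁ X' π₁ hπ₁ J₂ hJ₂fg hJ₂ hsupp₂ X'' π₂ hπ₂
    (twoLevelTower_good_of_suppCover p X X' π₁ b J₂ hoffStalk U hcover hdom hnoeth hjac hchar 𝔟 h𝔟 t v hv hv0 hcov hoff hon X'' π₂ hπ₂)

/-! ## Instance glue: N4/N4′'s chart binder `hoff` from the stalk clause (appended by res-L1-w45a-lead-1 gen 4) -/

/-- **Chart `hoff` from the stalk clause** (instance glue for N4 / N4′): on an affine open `U` of `X′` with a fibre ideal `𝔟`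
(`𝔟 ≤ 𝔭_z ⇒ z over b`, the converse direction of N4's `h𝔟` — N4b `map_primeIdealOf_le_iff` for a closed `b`), the FULL clause
at the stalks of `X′` over `b` off `supp J₂` gives the FULL clause at `Γ(X′,U)_Q` for every prime `Q ⊇ 𝔟` not containing
`J₂(U)`: the point `x′ = fromSpec Q` lies in `U` over `b`, off the support (`J₂(U) ≤ 𝔭_{x′}` on the support), and
`𝒪_{X′,x′} ≅ Γ(X′,U)_Q` (`IsAffineOpen.isLocalization_stalk'`). Its second component is N4's binder `hoff` at `Q`. [folklore] -/
theorem chartClause_of_stalkClause (p : ℕ) (X X' : Scheme.{0}) (π₁ : X' ⟶ X) (b : X) (J₂ : X'.IdealSheafData)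
    (U : X'.affineOpens) (𝔟 : Ideal Γ(X', U))
    (h𝔟' : ∀ z : ↥(Spec Γ(X', U)), 𝔟 ≤ z.asIdeal → π₁.base (U.2.fromSpec.base z) = b)
    (hoffStalk : ∀ x' : X', π₁.base x' = b → x' ∉ J₂.support →
      (IsDomain (X'.presheaf.stalk x') ∧ ∀ d : ℕ, ringKrullDim (X'.presheaf.stalk x') = d → ∀ s : Fin d → X'.presheaf.stalk x',
        (Ideal.span (Set.range s)).radical.IsMaximal → RingTheory.Sequence.IsWeaklyRegular (X'.presheaf.stalk x') (List.ofFn s) ∧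
        ∀ y : X'.presheaf.stalk x', (∃ e : ℕ, y ^ p ^ e ∈ Ideal.span ((fun z : X'.presheaf.stalk x' => z ^ p ^ e) ''
          (Ideal.span (Set.range s) : Set (X'.presheaf.stalk x')))) → y ∈ Ideal.span (Set.range s)))
    (Q : Ideal Γ(X', U)) [Q.IsPrime] (hQI : ¬ J₂.ideal U ≤ Q) (hQb : 𝔟 ≤ Q) :
    IsDomain (Localization.AtPrime Q) ∧ ∀ d : ℕ, ringKrullDim (Localization.AtPrime Q) = d → ∀ s : Fin d → Localization.AtPrime Q,
      (Ideal.span (Set.range s)).radical.IsMaximal →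
        RingTheory.Sequence.IsWeaklyRegular (Localization.AtPrime Q) (List.ofFn s) ∧
        ∀ y : Localization.AtPrime Q, (∃ e : ℕ, y ^ p ^ e ∈ Ideal.span
          ((fun z : Localization.AtPrime Q => z ^ p ^ e) ''
            (Ideal.span (Set.range s) : Set (Localization.AtPrime Q)))) → y ∈ Ideal.span (Set.range s) := by
  classical
  set z : ↥(Spec Γ(X', U)) := (⟨Q, inferInstance⟩ : PrimeSpectrum Γ(X', U)) with hz
  set x' : X' := U.2.fromSpec.base z with hx'
  have hx'U : x' ∈ (U : X'.Opens) := by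
    have h : x' ∈ Set.range U.2.fromSpec.base := ⟨z, rfl⟩
    rw [U.2.range_fromSpec] at h
    exact h
  have hb : π₁.base x' = b := h𝔟' z hQb
  -- `x′` is off the support: otherwise `J₂(U) ≤ 𝔭_{x′} = Q`
  have hnot : x' ∉ J₂.support := by
    intro hmem
    apply hQI
    intro g hg
    have h1 := (Scheme.IdealSheafData.mem_support_iff_of_mem (I := J₂) (U := U) hx'U).mp hmem
    rw [Scheme.mem_zeroLocus_iff] at h1
    have h2 : x' ∉ X'.basicOpen g := h1 g hg
    by_contra hgQ
    apply h2
    -- `fromSpec z ∈ D(g) ↔ g ∉ z`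
    have h3 : z ∈ U.2.fromSpec ⁻¹ᵁ X'.basicOpen g := by
      rw [U.2.fromSpec_preimage_basicOpen]
      exact (PrimeSpectrum.mem_basicOpen (f := g) z).mpr hgQ
    exact h3
  have hfull := hoffStalk x' hb hnot
  -- `𝒪_{X′,x′} ≅ Γ(X′,U)_Q`
  letI := TopCat.Presheaf.algebra_section_stalk X'.presheaf (⟨x', hx'U⟩ : (U : X'.Opens))
  haveI : IsLocalization.AtPrime (X'.presheaf.stalk x') z.asIdeal := U.2.isLocalization_stalk' z hx'U
  let e : Localization.AtPrime Q ≃+* X'.presheaf.stalk x' :=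
    (IsLocalization.algEquiv Q.primeCompl (Localization.AtPrime Q) (X'.presheaf.stalk x')).toRingEquiv
  exact fiClause_of_ringEquiv p e.symm hfull

end Summit.ResolutionOfSingularities.ResolutionOfSingularities.Theorems.FInjectiveMacaulayfication.TwoLevelTower

end
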